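import Literature.NumberTheory.Rogawski1990.GlobalAPacketMembership
import Literature.NumberTheory.Automorphic.DiscreteAutomorphicRepArchModuleCM
import Literature.NumberTheory.Automorphic.QuadraticHeckeCharacterCM
import Literature.NumberTheory.Automorphic.AdeleBaseChange
import Literature.RepresentationTheory.BorelWallach2000.UpqHodgeBigrading
import HarnessLib

/-!
# The S-layer letters S2♭ and R♭ of the Hodge-CM programme, rung 3, over the ξ-local family D6 ★ `MemXiFamily`
# (Rogawski 1990, Thm. 13.3.6 (c), Thm. 14.6.4, Prop. 15.2.1, §15.3, §12.3, §13.1, §4.13)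

Typ3 round-2 step (5), letters half (F0P3-plan (g3) ruling (T3): k = 2 new named facts; director s481∕s483).  TWO CLOSED named facts
`def … : Prop` in the hypothesis SHAPES `hS2` ∕ `hSgnRel` of ★ `F0P3SLayerFoldShapes.betaOpp_pointwise_of_SLayer` ∕ ★
`F0P3SLayerFoldShapesRel.betaOpp_pointwise_of_SLayer_rel` at `Ξ := OneDimAutRepH L`, `Mem P ξ := MemXiFamily P _ _ μω hμu ξ` (letter frame
`L ι H T hT hdef h2 μ` of ★ `CohomologicalSpectrumInnerForm`, then Rogawski's FIXED auxiliary Hecke character `μω` of `L` [§4.8 p. 51]: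
`hμu : μω.IsUnitary`, `hμω : μω|_{𝕀_{L⁺}} = ω_{L/L⁺}` — ★ `quadraticHeckeCharCM`, ★ `AdeleRing.ideleBaseChange`; such a `μω` exists by ★
`HewittRoss_heckeCharacter_extension_quadratic_holds`):
* `cohDiscrete_memXiFamily` (S2♭) — an `H¹`-cohomological discrete `P` of `U(H)` lies in the ξ-local family of SOME one-dimensional
  automorphic `ξ` [Thm. 14.6.4 + §15.3 ¶1 + Prop. 15.2.1 (b) + §13.1 p. 199 + Prop. 13.1.3 (d) + Lemma 4.13.1 (b)];
* `memXiFamily_cohTokens_sameType` (R♭) — two discrete `P, P′` in ONE ξ-local family have `H¹`-tokens of the SAME type at `ι` (COMPOSITE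
  READING, every step cited).
NOT here: S3♭ `memXiFamily_unique_of_hasFinComponent` (replaced in-house by the transfer T♭ over ★ `MemXiFamily.of_constituents`; a typed
fallback is kept in the programme HOME), M♭ (E1 is the packet-free ★ `innerFormMultiplicityLeOne`, line ED. 2.8).  The consumer is
`stub_betaOpp` of `Cruxes/H413/Lines/F0_U3LettersRung1.lean` via the K4-rel folds (planner's ED. 3).  FIDELITY NOTE of ★
`GlobalAPacketMembership`: `MemXiFamily` is an ENVELOPE ⊇ Rogawski's `Π′(ξ)`-membership; each letter below is derived from numbered print
for that envelope.  No instance, no notation, no `sorry`; new named facts: 2.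

## References
[Rogawski1990] §4.8 p. 51; §4.13 Lemma 4.13.1 (b); §12.2 pp. 173–174; §12.3 p. 178 (Prop. 12.3.3); §13.1 p. 199 (Prop. 13.1.3 (d));
§13.3 pp. 201–202 (Thm. 13.3.5, 13.3.6 (c)); §14.2 p. 232; §14.6 Thm. 14.6.4 (p. 246); Prop. 15.2.1, §15.3 ¶1.  [BernsteinZelevinsky1977]
Thm. 2.9.  [PlatonovRapinchuk1994] §7.3 Prop. 7.8.  [BorelWallach2000] II §5, VI Thm. 4.11.  HC_CM is proved only modulo the printed
citations until rung 0 closes.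
-/

-- Mathlib idiom (as in ★ `CohArchComponentRigid`, ★ `GKModules`): the commutator bracket on `Module.End ℂ M`, needed to MENTION
-- `(uFormGroup (Fin 2) (Fin 1)).lie →ₗ⁅ℝ⁆ Module.End ℂ M` in the letter shapes.
attribute [local instance 100] LieRing.ofAssociativeRing

set_option autoImplicit false

noncomputable section

open NumberField IsDedekindDomain MeasureTheory
open scoped Matrix ComplexOrder

namespace Literature.NumberTheory.Rogawski1990

open Literature.NumberTheory.Automorphic Literature.NumberTheory.Automorphic.UnitaryGroup
open Literature.NumberTheory.Automorphic.UnitaryGroup.CotangentForms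
open Literature.NumberTheory.GaloisRepresentations
open Literature.RepresentationTheory.BorelWallach2000
open Literature.RepresentationTheory.KonnoKonno2007

/-- **S2♭ — `H¹`-COHOMOLOGICAL DISCRETE REPRESENTATIONS LIE IN A ξ-LOCAL FAMILY.**  Letter frame: `L` CM with `[L⁺:ℚ] ≥ 2`, `ι`,
`H ∈ M₃(L)` with a frame `T` of signature `(2,1)` at `ι`, positive definite at the other complex places, an automorphic measure `μ`, and
Rogawski's auxiliary Hecke character `μω` of `L`, unitary, with `μω|_{𝕀_{L⁺}} = ω_{L/L⁺}` [§4.8 p. 51].  For every discrete automorphic `P`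
of `U(H)` whose archimedean module at `ι` (★ `P.archModuleCM ι T hT`) maps NON-TRIVIALLY and `(𝔤, K)`-equivariantly to an irreducible
`(𝔤, K)`-module of `U(2,1)` carrying a degree-one class of type `δ ∈ {±1}` (★ `upqTypeClasses … 1 δ ≠ ⊥`), there is a one-dimensional
automorphic `ξ` of `H` with `MemXiFamily P _ _ μω _ ξ`.  DERIVATION from numbered print: `H¹ ≠ 0` at `ι` ⇒ `P_ι ∈ {J⁺_φ, J⁻_φ}`
[Prop. 15.2.1 (b)] `= {πⁿ(ξ°_ι)}` [§12.3 p. 178] ⇒ the packet of `P` is `Π′(ξ)` for a one-dimensional automorphic `ξ` [§15.3 ¶1; Thm.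
13.3.6 (c) for `G`; Thm. 14.6.4 for `G′ = U(H)`: «Let `Π′ ∈ Π_a(G′)`. Then there exists a one-dimensional `ξ` … and `Π′ = Π′(ξ)`»] ⇒
`P_v ∈ Π(ξ_v)` for every finite `v` («`Π′(ξ_v) = Π(ξ_v)` for `v ∉ S₀`», p. 246) ⇒ at a non-split `v`, `P_v ∈ {πⁿ(ξ_v), πˢ(ξ_v)}`,
`πⁿ(ξ_v) ∈ JH(i_G(χ_ξ))` [§12.2 p. 174], `πˢ(ξ_v)` supercuspidal [Prop. 13.1.3 (d)]; at a split `v`, `P_v = i_G(ξ_v ⊗ μ_w ∘ det₀)`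
[Lemma 4.13.1 (b); §13.3 p. 201] — inside the envelope `IsXiLocalFamily` (the identifications `G′_v ≅ G_v` of §14.2 are form
congruences, inner up to the centre). ⊇ Rogawski's `Π(ξ)`-membership; equality not claimed.
[cite: Rogawski1990, §14.6 Thm. 14.6.4 (p. 246); Thm. 13.3.6 (c) (p. 202); §15.3 ¶1 and Prop. 15.2.1 (b) (pp. 249–251); §13.1 p. 199 and Prop. 13.1.3 (d); §12.2 p. 174; §4.13 Lemma 4.13.1 (b); §13.3 p. 201; §14.2 p. 232; §12.3 p. 178; §4.8 p. 51]
[cite: BorelWallach2000, VI Thm. 4.11] -/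
def cohDiscrete_memXiFamily : Prop :=
  ∀ (L : Type) [Field L] [NumberField L] [IsCMField L] (ι : L →+* ℂ) (H : Matrix (Fin 3) (Fin 3) L) (T : GL (Fin 3) ℂ)
    (hT : (T : Matrix (Fin 3) (Fin 3) ℂ)ᴴ * H.map ι * (T : Matrix (Fin 3) (Fin 3) ℂ) = Literature.Geometry.ComplexHyperbolic.BallModel.J),
    (∀ τ' : L →+* ℂ, InfinitePlace.mk τ' ≠ InfinitePlace.mk ι → (H.map τ').PosDef) →
    2 ≤ Module.finrank ℚ ↥(maximalRealSubfield L) →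
    ∀ (μ : Measure (adelicGroupData (↥(maximalRealSubfield L)) L (IsCMField.complexConj L) 3 H).automorphicQuotient)
      [(adelicGroupData (↥(maximalRealSubfield L)) L (IsCMField.complexConj L) 3 H).IsAutomorphicMeasure μ]
      (μω : HeckeCharacter L) (hμu : μω.IsUnitary),
      (∀ x : ideleGroup ↥(maximalRealSubfield L),
        μω (AdeleRing.ideleBaseChange (↥(maximalRealSubfield L)) L x) = quadraticHeckeCharCM L x) →
    ∀ (P : DiscreteAutomorphicRep (adelicGroupData (↥(maximalRealSubfield L)) L (IsCMField.complexConj L) 3 H) μ)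
      (M : Type) [AddCommGroup M] [Module ℂ M] (σK : Representation ℂ (uFormGroup (Fin 2) (Fin 1)).maximalCompact M)
      (σ𝔤 : (uFormGroup (Fin 2) (Fin 1)).lie →ₗ⁅ℝ⁆ Module.End ℂ M) (hM : IsGKModule (uFormGroup (Fin 2) (Fin 1)) σK σ𝔤),
      IsIrreducibleGK σK σ𝔤 →
      (∃ T₁ : P.archModuleCM ι T hT →ₗ[ℂ] M,
        (∀ (k : (uFormGroup (Fin 2) (Fin 1)).maximalCompact) (w : P.archModuleCM ι T hT),
            T₁ (P.archRepKCM ι T hT k w) = σK k (T₁ w)) ∧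
          (∀ (X : (uFormGroup (Fin 2) (Fin 1)).lie) (w : P.archModuleCM ι T hT),
            T₁ (P.archRepLieCM ι T hT X w) = σ𝔤 X (T₁ w)) ∧ T₁ ≠ 0) →
      ∀ δ : ℤ, (δ = 1 ∨ δ = -1) → upqTypeClasses σK σ𝔤 hM.ad_compat 1 δ ≠ ⊥ →
        ∃ ξ : OneDimAutRepH L,
          MemXiFamily P (transpose_map_cmConjRingHom_eq_of_frame L ι H T hT) (isUnit_det_of_frame L ι H T hT) μω hμu ξ

/-- **R♭ — TWO DISCRETE REPRESENTATIONS IN ONE ξ-LOCAL FAMILY HAVE THE SAME ARCHIMEDEAN TYPE AT `ι` (relative sign clause; COMPOSITE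
READING).**  Same frame.  If `MemXiFamily P … ξ` and `MemXiFamily P′ … ξ` (the SAME `ξ`, the same `μω`) and the archimedean modules of `P`,
`P′` at `ι` detect irreducible `(𝔤, K)`-modules `M`, `M′` with degree-one classes of types `δ, δ′ ∈ {±1}`, then `δ = δ′`.  DERIVATION:
(1) `H¹ ≠ 0` at `ι` ⇒ `P ∈ Π′(ξ₁)`, `P′ ∈ Π′(ξ₂)` for one-dimensional automorphic `ξ₁, ξ₂` [Thm. 14.6.4; §15.3 ¶1; Prop. 15.2.1 (b)];
(2) `P ∈ Π′(ξ₁)` makes `P` a member of the ξ₁-local family (as in S2♭), and with `MemXiFamily P … ξ` steps (2)–(4) of S3♭ (applied to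
`P` alone: split places [Lemma 4.13.1 (b); BernsteinZelevinsky1977 Thm. 2.9], the cofinitely many non-supercuspidal non-split places
[§12.2 pp. 173–174], weak approximation for `U(1)_{L/L⁺}` [PlatonovRapinchuk1994 §7.3 Prop. 7.8]) give `ξ₁ = ξ`; likewise `ξ₂ = ξ`;
(3) hence `P_ι, P′_ι ∈ Π′(ξ_ι) ∩ {H¹ ≠ 0} = {πⁿ(ξ_ι)}` (`πˢ(ξ_∞) ∈ {D^∓_φ, π²}` has no `H¹`, Prop. 15.2.1 (a)) and `πⁿ(ξ_ι)` is `J⁺_φ` or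
`J⁻_φ` according to `ξ_ι` alone [§12.3 p. 178, Prop. 12.3.3] — one type; an irreducible module carries classes of at most one type
[BorelWallach2000, II §5].  No sign CONVENTION is asserted (ruling (Q)).
[cite: Rogawski1990, §14.6 Thm. 14.6.4 (p. 246); §12.3 p. 178 (Prop. 12.3.3); Prop. 15.2.1 (a)(b); §15.3 ¶1; §13.1 p. 199; §12.2 pp. 173–174; §4.13 Lemma 4.13.1 (b)]
[cite: BernsteinZelevinsky1977, Thm. 2.9] [cite: PlatonovRapinchuk1994, §7.3 Prop. 7.8] [cite: BorelWallach2000, II §5; VI Thm. 4.11] -/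
def memXiFamily_cohTokens_sameType : Prop :=
  ∀ (L : Type) [Field L] [NumberField L] [IsCMField L] (ι : L →+* ℂ) (H : Matrix (Fin 3) (Fin 3) L) (T : GL (Fin 3) ℂ)
    (hT : (T : Matrix (Fin 3) (Fin 3) ℂ)ᴴ * H.map ι * (T : Matrix (Fin 3) (Fin 3) ℂ) = Literature.Geometry.ComplexHyperbolic.BallModel.J),
    (∀ τ' : L →+* ℂ, InfinitePlace.mk τ' ≠ InfinitePlace.mk ι → (H.map τ').PosDef) →
    2 ≤ Module.finrank ℚ ↥(maximalRealSubfield L) →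
    ∀ (μ : Measure (adelicGroupData (↥(maximalRealSubfield L)) L (IsCMField.complexConj L) 3 H).automorphicQuotient)
      [(adelicGroupData (↥(maximalRealSubfield L)) L (IsCMField.complexConj L) 3 H).IsAutomorphicMeasure μ]
      (μω : HeckeCharacter L) (hμu : μω.IsUnitary),
      (∀ x : ideleGroup ↥(maximalRealSubfield L),
        μω (AdeleRing.ideleBaseChange (↥(maximalRealSubfield L)) L x) = quadraticHeckeCharCM L x) →
    ∀ (P P' : DiscreteAutomorphicRep (adelicGroupData (↥(maximalRealSubfield L)) L (IsCMField.complexConj L) 3 H) μ)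
      (ξ : OneDimAutRepH L),
      MemXiFamily P (transpose_map_cmConjRingHom_eq_of_frame L ι H T hT) (isUnit_det_of_frame L ι H T hT) μω hμu ξ →
      MemXiFamily P' (transpose_map_cmConjRingHom_eq_of_frame L ι H T hT) (isUnit_det_of_frame L ι H T hT) μω hμu ξ →
      ∀ (M : Type) [AddCommGroup M] [Module ℂ M] (σK : Representation ℂ (uFormGroup (Fin 2) (Fin 1)).maximalCompact M)
        (σ𝔤 : (uFormGroup (Fin 2) (Fin 1)).lie →ₗ⁅ℝ⁆ Module.End ℂ M) (hM : IsGKModule (uFormGroup (Fin 2) (Fin 1)) σK σ𝔤),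
        IsIrreducibleGK σK σ𝔤 →
        (∃ T₁ : P.archModuleCM ι T hT →ₗ[ℂ] M,
          (∀ (k : (uFormGroup (Fin 2) (Fin 1)).maximalCompact) (w : P.archModuleCM ι T hT),
              T₁ (P.archRepKCM ι T hT k w) = σK k (T₁ w)) ∧
            (∀ (X : (uFormGroup (Fin 2) (Fin 1)).lie) (w : P.archModuleCM ι T hT),
              T₁ (P.archRepLieCM ι T hT X w) = σ𝔤 X (T₁ w)) ∧ T₁ ≠ 0) →
      ∀ (M' : Type) [AddCommGroup M'] [Module ℂ M'] (σK' : Representation ℂ (uFormGroup (Fin 2) (Fin 1)).maximalCompact M')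
        (σ𝔤' : (uFormGroup (Fin 2) (Fin 1)).lie →ₗ⁅ℝ⁆ Module.End ℂ M') (hM' : IsGKModule (uFormGroup (Fin 2) (Fin 1)) σK' σ𝔤'),
        IsIrreducibleGK σK' σ𝔤' →
        (∃ T₂ : P'.archModuleCM ι T hT →ₗ[ℂ] M',
          (∀ (k : (uFormGroup (Fin 2) (Fin 1)).maximalCompact) (w : P'.archModuleCM ι T hT),
              T₂ (P'.archRepKCM ι T hT k w) = σK' k (T₂ w)) ∧
            (∀ (X : (uFormGroup (Fin 2) (Fin 1)).lie) (w : P'.archModuleCM ι T hT),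
              T₂ (P'.archRepLieCM ι T hT X w) = σ𝔤' X (T₂ w)) ∧ T₂ ≠ 0) →
      ∀ (δ δ' : ℤ), (δ = 1 ∨ δ = -1) → (δ' = 1 ∨ δ' = -1) →
        upqTypeClasses σK σ𝔤 hM.ad_compat 1 δ ≠ ⊥ → upqTypeClasses σK' σ𝔤' hM'.ad_compat 1 δ' ≠ ⊥ → δ = δ'

end Literature.NumberTheory.Rogawski1990

end
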